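import Literature.NumberTheory.EllipticCurves.SelmerCorankIsogenyProofs
import HarnessLib

/-!
# `#ker Ш(φ) ≤ #Ш(E/K)[n] ≤ #ker Ш(φ) · #ker Ш(φ̂)` for a dual pair of isogenies `φ̂ ∘ φ = [n]`
# (Milne, *ADT*, proof of Lemma I.7.1(b); Silverman, *AEC*, X.4.2(a), proof of Prop. X.6.2(c))

Topic `NumberTheory/EllipticCurves`, family `bsd`. THEOREMS ONLY (no definition, no named fact, no `sorry`).
For `K`-isogenies `φ : E → E'`, `ψ : E' → E` of elliptic curves over a number field with `ψ ∘ φ = [n]` on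
`K̄`-points (`ψ = φ̂`, `n = deg φ`; Silverman III.6.1), the tree's `Ш(φ) = shaMap φ …`, `Ш(ψ)` satisfy
`Ш(ψ) ∘ Ш(φ) = n` (`Isogeny.shaMap_shaMap_of_comp_eq_nsmul`) and `ker Ш(φ) ⊆ Ш(E)[n]` (`ker_shaMap_le_torsionBy`).
This file records the exact sequence `0 → ker Ш(φ) → Ш(E)[n] → ker Ш(ψ)` in cardinalities — the BRACKET by which an
`n`-isogeny descent (which computes the two kernels `Ш(E)[φ]`, `Ш(E')[φ̂]` from Selmer and point counts) bounds `#Ш(E/K)[n]`: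

* `Isogeny.natCard_ker_shaMap_le_natCard_sha_torsionBy` — `#ker Ш(φ) ≤ #Ш(E/K)[n]` (`n ≠ 0`; `Ш[n]` finite by weak Mordell–Weil);
* `Isogeny.natCard_sha_torsionBy_le_mul_natCard_ker_shaMap` — **`#Ш(E/K)[n] ≤ #ker Ш(φ) · #ker Ш(ψ)`** (kernels finite):
  `Ш(φ)` maps `Ш(E)[n]` into `ker Ш(ψ)` (`Ш(ψ)(Ш(φ) c) = n c = 0`) with kernel inside `ker Ш(φ)`;
* `Isogeny.sha_torsionBy_eq_bot_of_ker_shaMap_eq_bot` — both kernels trivial (`n ≠ 0`) ⟹ `Ш(E/K)[n] = 0` (the sharp case, as used by every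
  complete isogeny descent in the tree);
* `Isogeny.natCard_sha_torsionBy_eq_of_ker_shaMap_eq_bot` — `ker Ш(ψ) = ⊥ ⟹ #Ш(E/K)[n] = #ker Ш(φ)`.

The `2`-isogeny case in the `Ξ`-currency of `TwoIsogenySelmerGroupSha` is `TwoIsogenyShaTwoTorsionBound`; this file is
degree-free (it serves the `3`-isogeny `CPMuDescent` and the `5`-isogeny `KubertTate` descents equally).

## References

* J. S. Milne, *Arithmetic Duality Theorems*, 2nd ed. (2006), Ch. I, proof of Lemma 7.1(b), p. 96. [MilneADT2006]
* J. H. Silverman, *The Arithmetic of Elliptic Curves*, 2nd ed. (2009), Thm. III.6.1, Thm. X.4.2, proof of Prop. X.6.2(c).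
  [SilvermanAEC2009]
-/

noncomputable section

open scoped Classical
open scoped AddSubgroup

universe u

namespace WeierstrassCurve

open Literature.NumberTheory.EllipticCurves

variable {K : Type u} [Field K] [NumberField K] {W W' : WeierstrassCurve K}

namespace Isogeny

/-- **`#ker Ш(φ) ≤ #Ш(E/K)[n]`** for `ψ ∘ φ = [n]`, `n ≠ 0` (`ker Ш(φ) ⊆ Ш(E)[n]`, and `Ш(E)[n]` is finite by weak
Mordell–Weil, `finite_sha_torsionBy_holds`). [cite: MilneADT2006, Ch. I Lemma 7.1(b) (proof), p. 96] -/
theorem natCard_ker_shaMap_le_natCard_sha_torsionBy [W.IsElliptic] (φ : Isogeny W W') (ψ : Isogeny W' W) {n : ℕ}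
    (hn : n ≠ 0)
    (h : ∀ P, ψ (φ P) = (n : ℤ) • P) :
    Nat.card (shaMap φ.toAddMonoidHom φ.equivariant φ.hasLocalPointsMaps_toAddMonoidHom).ker ≤
      Nat.card (W.sha[(n : ℤ)]) := by
  haveI : Finite (W.sha[(n : ℤ)]) := W.finite_sha_torsionBy_holds (n : ℤ) (by exact_mod_cast hn)
  exact Nat.card_le_card_of_injective
    (AddSubgroup.inclusion (ker_shaMap_le_torsionBy φ.toAddMonoidHom φ.equivariant
      φ.hasLocalPointsMaps_toAddMonoidHom ψ.toAddMonoidHom ψ.equivariant (fun P ↦ h P)))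
    (AddSubgroup.inclusion_injective _)

/-- **`#Ш(E/K)[n] ≤ #ker Ш(φ) · #ker Ш(ψ)`** for `K`-isogenies `φ : E → E'`, `ψ : E' → E` with `ψ ∘ φ = [n]` and finite
kernels `ker Ш(φ)`, `ker Ш(ψ)`: the exact sequence `0 → ker Ш(φ) → Ш(E)[n] → ker Ш(ψ)` (`Ш(ψ)(Ш(φ) c) = n c`).
[cite: MilneADT2006, Ch. I Lemma 7.1(b) (proof), p. 96] [cite: SilvermanAEC2009, proof of Prop. X.6.2(c)] -/
theorem natCard_sha_torsionBy_le_mul_natCard_ker_shaMap (φ : Isogeny W W') (ψ : Isogeny W' W) {n : ℕ}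
    (h : ∀ P, ψ (φ P) = (n : ℤ) • P)
    [hB : Finite (shaMap φ.toAddMonoidHom φ.equivariant φ.hasLocalPointsMaps_toAddMonoidHom).ker]
    [hB' : Finite (shaMap ψ.toAddMonoidHom ψ.equivariant ψ.hasLocalPointsMaps_toAddMonoidHom).ker] :
    Nat.card (W.sha[(n : ℤ)]) ≤
      Nat.card (shaMap φ.toAddMonoidHom φ.equivariant φ.hasLocalPointsMaps_toAddMonoidHom).ker *
        Nat.card (shaMap ψ.toAddMonoidHom ψ.equivariant ψ.hasLocalPointsMaps_toAddMonoidHom).ker := by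
  set Φ := shaMap φ.toAddMonoidHom φ.equivariant φ.hasLocalPointsMaps_toAddMonoidHom with hΦ
  set Ψ := shaMap ψ.toAddMonoidHom ψ.equivariant ψ.hasLocalPointsMaps_toAddMonoidHom with hΨ
  set A : AddSubgroup W.sha := W.sha[(n : ℤ)] with hA
  -- `Ш(φ)` maps `Ш(E)[n]` into `ker Ш(ψ)`
  have hmap : ∀ c ∈ A, Φ c ∈ Ψ.ker := by
    intro c hc
    rw [AddMonoidHom.mem_ker, hΦ, hΨ, shaMap_shaMap_of_comp_eq_nsmul φ ψ h c]
    exact AddSubgroup.torsionBy.nsmul_iff.mp hc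
  let f : ↥A →+ ↥Ψ.ker :=
    { toFun := fun c ↦ ⟨Φ c, hmap c c.2⟩
      map_zero' := Subtype.ext (by simp)
      map_add' := fun c d ↦ Subtype.ext (by simp) }
  -- its kernel injects into `ker Ш(φ)`
  have hker : ∀ c : ↥A, f c = 0 → (c : W.sha) ∈ Φ.ker := by
    intro c hc0
    rw [AddMonoidHom.mem_ker]
    exact congrArg Subtype.val hc0
  have h1 : Nat.card ↥A = Nat.card (↥A ⧸ f.ker) * Nat.card ↥f.ker :=
    AddSubgroup.card_eq_card_quotient_mul_card_addSubgroup f.ker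
  have h2 : Nat.card (↥A ⧸ f.ker) ≤ Nat.card ↥Ψ.ker := by
    rw [Nat.card_congr (QuotientAddGroup.quotientKerEquivRange f).toEquiv]
    exact Nat.card_le_card_of_injective (fun x : f.range ↦ (x : ↥Ψ.ker)) Subtype.val_injective
  have h3 : Nat.card ↥f.ker ≤ Nat.card ↥Φ.ker := by
    refine Nat.card_le_card_of_injective (fun c : f.ker ↦ (⟨((c : ↥A) : W.sha), hker c c.2⟩ : ↥Φ.ker)) ?_
    intro x y hxy
    exact Subtype.ext (Subtype.ext (congrArg (fun z : ↥Φ.ker ↦ (z : W.sha)) hxy))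
  calc Nat.card ↥A = Nat.card (↥A ⧸ f.ker) * Nat.card ↥f.ker := h1
    _ ≤ Nat.card ↥Ψ.ker * Nat.card ↥Φ.ker := Nat.mul_le_mul h2 h3
    _ = Nat.card ↥Φ.ker * Nat.card ↥Ψ.ker := Nat.mul_comm _ _

/-- **The sharp case: both kernels trivial ⟹ `Ш(E/K)[n] = 0`** (what every complete isogeny descent of the tree uses,
here degree-free). [cite: SilvermanAEC2009, Thm. X.4.2(a) and Thm. III.6.1(a)] -/
theorem sha_torsionBy_eq_bot_of_ker_shaMap_eq_bot [W.IsElliptic] (φ : Isogeny W W') (ψ : Isogeny W' W) {n : ℕ}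
    (hn : n ≠ 0) (h : ∀ P, ψ (φ P) = (n : ℤ) • P)
    (hφ : (shaMap φ.toAddMonoidHom φ.equivariant φ.hasLocalPointsMaps_toAddMonoidHom).ker = ⊥)
    (hψ : (shaMap ψ.toAddMonoidHom ψ.equivariant ψ.hasLocalPointsMaps_toAddMonoidHom).ker = ⊥) :
    W.sha[(n : ℤ)] = ⊥ := by
  haveI : Finite (shaMap φ.toAddMonoidHom φ.equivariant φ.hasLocalPointsMaps_toAddMonoidHom).ker := by
    rw [hφ]; infer_instance
  haveI : Finite (shaMap ψ.toAddMonoidHom ψ.equivariant ψ.hasLocalPointsMaps_toAddMonoidHom).ker := by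
    rw [hψ]; infer_instance
  have hle := natCard_sha_torsionBy_le_mul_natCard_ker_shaMap φ ψ h
  simp only [hφ, hψ, AddSubgroup.card_bot, mul_one] at hle
  haveI : Finite (W.sha[(n : ℤ)]) := W.finite_sha_torsionBy_holds (n : ℤ) (by exact_mod_cast hn)
  exact AddSubgroup.eq_bot_of_card_le _ hle

/-- **Sharp dual side ⟹ `#Ш(E/K)[n] = #ker Ш(φ)`**: if `ker Ш(ψ) = ⊥` (and `n ≠ 0`, `ker Ш(φ)` finite), the bracket closes.
[cite: SilvermanAEC2009, proof of Prop. X.6.2(c)] -/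
theorem natCard_sha_torsionBy_eq_of_ker_shaMap_eq_bot [W.IsElliptic] (φ : Isogeny W W') (ψ : Isogeny W' W) {n : ℕ}
    (hn : n ≠ 0)
    (h : ∀ P, ψ (φ P) = (n : ℤ) • P)
    [Finite (shaMap φ.toAddMonoidHom φ.equivariant φ.hasLocalPointsMaps_toAddMonoidHom).ker]
    (hψ : (shaMap ψ.toAddMonoidHom ψ.equivariant ψ.hasLocalPointsMaps_toAddMonoidHom).ker = ⊥) :
    Nat.card (W.sha[(n : ℤ)]) =
      Nat.card (shaMap φ.toAddMonoidHom φ.equivariant φ.hasLocalPointsMaps_toAddMonoidHom).ker := by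
  haveI : Finite (shaMap ψ.toAddMonoidHom ψ.equivariant ψ.hasLocalPointsMaps_toAddMonoidHom).ker := by
    rw [hψ]; infer_instance
  have hle := natCard_sha_torsionBy_le_mul_natCard_ker_shaMap φ ψ h
  simp only [hψ, AddSubgroup.card_bot, mul_one] at hle
  exact le_antisymm hle (natCard_ker_shaMap_le_natCard_sha_torsionBy φ ψ hn h)

end Isogeny

end WeierstrassCurve

end
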